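import Summits.Ventures.CertifiedManyBodySolver.Rows.HalfFilledTLTorusStag
import Literature.MathematicalPhysics.QuantumLattice.HubbardDoubleOccupancyBounds

/-!
# M2 rows, part 16: finite even tori — the kinetic cell `T{L}_k` (DERIVED from `T{L}_E` and `T{L}_D`)

HONEST FRAMING (speedrun cell `mbsolver`, M2): first certified bounds; not a superconductivity
verdict; every number certified or labelled float.  This file contains NO numbers: it supplies the
typed home of the finite-torus kinetic cells `T{L}_k` of the M2 table (`HOME/m2/M2-TABLE.md`: "kinetic
energy per site `k = ⟨T⟩/L²`, `L × L` torus, PBC, `N = L²` ground states — DERIVED `= E₀/L² − U·d` by exact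
interval arithmetic on `T{L}_E` and `T{L}_D`"), which until now were names-only in the Lean column (the
audit's four standing `T4_k_U*: no Prop` issues), and it PROVES the derivation the table performs:

* `M2.kineticDensity L ψ = Re⟨ψ, T̂ψ⟩/L²` with `T̂ = hamiltonian (fermionTorusGraph 2 L) 1 0` (the `t = 1`
  hopping operator; `hamiltonian G t U = T̂_t + U • D̂` literally, `HubbardWave0.hamiltonian`), the rows
  `M2.TorusKineticRow L U lo hi` / `TorusKinetic{Lower,Upper}Row` (every normalised `L²`-particle ground
  state, the `∀ψ` shape of `TorusDoccRow`), `iff`, `of_lower_upper`, outward roundings `.mono`;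
* the finite-volume bookkeeping identity `k_L(ψ) = Re⟨ψ, H(1,U)ψ⟩/L² − U·d_L(ψ)` for EVERY vector
  (`kineticDensity_eq_sub`, from the Literature identity `DoubleOccupancy.re_expect_hamiltonian_eq`:
  `H(t,U') = H(t,U) + (U'−U)•D̂`), hence `k_L(ψ) = E₀(L×L, 1, U, L²)/L² − U·d_L(ψ)` on normalised ground
  states (`kineticDensity_eq_groundEnergyAt_sub`, part 4's `re_expect_hamiltonian_eq_groundEnergyAt`);
* THE EDGE the table uses, `U ≥ 0`: `TorusKineticLowerRow.of_energyLower_doccUpper`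
  (`klo·L² ≤ elo − U·dhi·L²`), `TorusKineticUpperRow.of_energyUpper_doccLower`
  (`ehi − U·dlo·L² ≤ khi·L²`), `TorusKineticRow.of_energy_docc` (both; side goals are closed rational
  arithmetic at numerals `L`, `U`, decided by `norm_num` at the use site), and conversely (`U > 0`)
  `TorusDoccRow.of_energy_kinetic` (`d_L = (E₀/L² − k_L)/U`).

A torus number is never a thermodynamic-limit number here (the TL kinetic row is part 4's `M2.KineticRow`,
filled by certificates or by `KineticRow.of_energy_docc`); the `T{L}_k` cells inherit the status of their
inputs (substrate / conditional on the E2 sector ceiling) — this file only makes the DERIVED arrow a theorem.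

References: Lieb–Wu, PRL 20 (1968) 1445, eq. (15) (`∂E/∂U = Σ⟨n↑n↓⟩`); Tasaki, *Physics and
Mathematics of Quantum Many-Body Systems* (2020) §2.1 (ground states), §10.1; Koma–Tasaki, J. Stat.
Phys. 76 (1994) 745, §1.
-/

noncomputable section

namespace Summit.Ventures.CertifiedManyBodySolver

open Literature.MathematicalPhysics.QuantumLattice
open Matrix HubbardWave0 Literature.Probability.LatticeModels FermionSpinMoment ThermodynamicLimit
  Filter Topology
open scoped ComplexOrder BigOperators

namespace M2

section TorusKinetic

variable {L : ℕ} [NeZero L]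

/-! ## §1 The kinetic-energy density of a torus vector and the rows `T{L}_k` -/

/-- The KINETIC-ENERGY DENSITY `k_L(ψ) = Re ⟨ψ, T̂ ψ⟩ / L²` of a torus vector, `T̂ = H(t = 1, U = 0)
= −Σ_{x∼y,σ} c†_{xσ}c_{yσ}` the hopping operator of the `L × L` torus (`hamiltonian G 1 0`; its
interaction term is `(0 : ℂ) • D̂`). [cite: LiebWu1968, eq. (15)] -/
def kineticDensity (L : ℕ) [NeZero L] (ψ : Fock (Orb (FermionTorus 2 L))) : ℝ :=
  (expect (hamiltonian (fermionTorusGraph 2 L) 1 0) ψ).re / (L : ℝ) ^ 2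

/-- **Finite-torus kinetic row** `T{L}_k` (`N = L²`, every normalised ground state of `H(1,U)`):
`lo ≤ k_L(ψ) ≤ hi`; a row AT `L`, compared with QMC at the same `L`, never a TL row.
[cite: LiebWu1968, eq. (15)] [cite: Tasaki2020, §2.1] -/
def TorusKineticRow (L : ℕ) [NeZero L] (U : ℝ) (lo hi : ℚ) : Prop :=
  ∀ ψ : Fock (Orb (FermionTorus 2 L)), IsGroundState (hamiltonian (fermionTorusGraph 2 L) 1 U) (L ^ 2) ψ →
    star ψ ⬝ᵥ ψ = 1 → ((lo : ℚ) : ℝ) ≤ kineticDensity L ψ ∧ kineticDensity L ψ ≤ ((hi : ℚ) : ℝ)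

/-- One-sided: the kinetic floor `lo ≤ k_L(ψ)` on normalised `L²`-particle ground states (cell
`T{L}_k.lo`). [cite: LiebWu1968, eq. (15)] -/
def TorusKineticLowerRow (L : ℕ) [NeZero L] (U : ℝ) (lo : ℚ) : Prop :=
  ∀ ψ : Fock (Orb (FermionTorus 2 L)), IsGroundState (hamiltonian (fermionTorusGraph 2 L) 1 U) (L ^ 2) ψ →
    star ψ ⬝ᵥ ψ = 1 → ((lo : ℚ) : ℝ) ≤ kineticDensity L ψ

/-- One-sided: the kinetic ceiling `k_L(ψ) ≤ hi` on normalised `L²`-particle ground states (cell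
`T{L}_k.hi`). [cite: LiebWu1968, eq. (15)] -/
def TorusKineticUpperRow (L : ℕ) [NeZero L] (U : ℝ) (hi : ℚ) : Prop :=
  ∀ ψ : Fock (Orb (FermionTorus 2 L)), IsGroundState (hamiltonian (fermionTorusGraph 2 L) 1 U) (L ^ 2) ψ →
    star ψ ⬝ᵥ ψ = 1 → kineticDensity L ψ ≤ ((hi : ℚ) : ℝ)

/-- Floor and ceiling make the two-sided row. [cite: LiebWu1968, eq. (15)] -/
theorem TorusKineticRow.of_lower_upper {U : ℝ} {lo hi : ℚ} (hlo : TorusKineticLowerRow L U lo)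
    (hhi : TorusKineticUpperRow L U hi) : TorusKineticRow L U lo hi :=
  fun ψ hψ h1 => ⟨hlo ψ hψ h1, hhi ψ hψ h1⟩

/-- `TorusKineticRow = TorusKineticLowerRow ∧ TorusKineticUpperRow`. [cite: LiebWu1968, eq. (15)] -/
theorem torusKineticRow_iff {U : ℝ} {lo hi : ℚ} :
    TorusKineticRow L U lo hi ↔ TorusKineticLowerRow L U lo ∧ TorusKineticUpperRow L U hi :=
  ⟨fun h => ⟨fun ψ hψ h1 => (h ψ hψ h1).1, fun ψ hψ h1 => (h ψ hψ h1).2⟩,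
    fun h => TorusKineticRow.of_lower_upper h.1 h.2⟩

/-- Outward rounding of a kinetic floor. [folklore] -/
theorem TorusKineticLowerRow.mono {U : ℝ} {q lo : ℚ} (h : TorusKineticLowerRow L U q) (hlo : lo ≤ q) :
    TorusKineticLowerRow L U lo :=
  fun ψ hψ h1 => ((Rat.cast_le (K := ℝ)).2 hlo).trans (h ψ hψ h1)

/-- Outward rounding of a kinetic ceiling. [folklore] -/
theorem TorusKineticUpperRow.mono {U : ℝ} {q hi : ℚ} (h : TorusKineticUpperRow L U q) (hhi : q ≤ hi) :
    TorusKineticUpperRow L U hi :=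
  fun ψ hψ h1 => (h ψ hψ h1).trans ((Rat.cast_le (K := ℝ)).2 hhi)

/-- Outward rounding of the two-sided row. [folklore] -/
theorem TorusKineticRow.mono {U : ℝ} {qlo qhi lo hi : ℚ} (h : TorusKineticRow L U qlo qhi)
    (hlo : lo ≤ qlo) (hhi : qhi ≤ hi) : TorusKineticRow L U lo hi :=
  TorusKineticRow.of_lower_upper ((torusKineticRow_iff.1 h).1.mono hlo) ((torusKineticRow_iff.1 h).2.mono hhi)

/-! ## §2 `k_L = Re⟨ψ, Hψ⟩/L² − U·d_L` (every vector) and `= E₀/L² − U·d_L` (ground states) -/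

/-- **Finite-volume bookkeeping, every vector `ψ`**: `k_L(ψ) = Re⟨ψ, H(1,U)ψ⟩/L² − U·d_L(ψ)`
(`H(1,U) = T̂ + U•D̂`, via the Literature identity `H(t,U') = H(t,U) + (U'−U)•D̂`).
[cite: LiebWu1968, eq. (15)] -/
theorem kineticDensity_eq_sub (U : ℝ) (ψ : Fock (Orb (FermionTorus 2 L))) :
    kineticDensity L ψ =
      (expect (hamiltonian (fermionTorusGraph 2 L) 1 U) ψ).re / (L : ℝ) ^ 2 - U * doccDensity L ψ := by
  unfold kineticDensity doccDensity
  rw [DoubleOccupancy.re_expect_hamiltonian_eq (fermionTorusGraph 2 L) 1 U 0 ψ]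
  ring

/-- The same identity multiplied out: `Re⟨ψ, H(1,U)ψ⟩ = L²·k_L(ψ) + U·L²·d_L(ψ)`.
[cite: LiebWu1968, eq. (15)] -/
theorem re_expect_hamiltonian_eq_kinetic_add_docc (U : ℝ) (ψ : Fock (Orb (FermionTorus 2 L))) :
    (expect (hamiltonian (fermionTorusGraph 2 L) 1 U) ψ).re =
      (L : ℝ) ^ 2 * kineticDensity L ψ + U * ((L : ℝ) ^ 2 * doccDensity L ψ) := by
  have hL0 : (L : ℝ) ^ 2 ≠ 0 := by have := NeZero.pos L; positivity
  rw [kineticDensity_eq_sub U ψ, mul_sub, mul_div_cancel₀ _ hL0]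
  ring

/-- **On a normalised `L²`-particle ground state**: `k_L(ψ) = E₀(L × L, 1, U, L²)/L² − U·d_L(ψ)`
(part 4's `re_expect_hamiltonian_eq_groundEnergyAt`). [cite: Tasaki2020, §2.1] [cite: LiebWu1968, eq. (15)] -/
theorem kineticDensity_eq_groundEnergyAt_sub {U : ℝ} {ψ : Fock (Orb (FermionTorus 2 L))}
    (hψ : IsGroundState (hamiltonian (fermionTorusGraph 2 L) 1 U) (L ^ 2) ψ) (h1 : star ψ ⬝ᵥ ψ = 1) :
    kineticDensity L ψ =
      groundEnergyAt (fermionTorusGraph 2 L) 1 U (L ^ 2) / (L : ℝ) ^ 2 - U * doccDensity L ψ := by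
  rw [kineticDensity_eq_sub U ψ, re_expect_hamiltonian_eq_groundEnergyAt _ hψ h1]

/-! ## §3 The DERIVED edges `T{L}_E`, `T{L}_D` ⟹ `T{L}_k` (and back) -/

/-- **`T{L}_k.lo` from `T{L}_E.lo` and `T{L}_D.hi`** (`U ≥ 0`): `klo·L² ≤ elo − U·dhi·L²` gives
`TorusKineticLowerRow L U klo`. [cite: LiebWu1968, eq. (15)] [cite: Tasaki2020, §2.1] -/
theorem TorusKineticLowerRow.of_energyLower_doccUpper {U : ℝ} (hU : 0 ≤ U) {elo dhi klo : ℚ}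
    (he : TorusEnergyLowerRow L U elo) (hd : TorusDoccUpperRow L U dhi)
    (hk : ((klo : ℚ) : ℝ) * (L : ℝ) ^ 2 ≤ (elo : ℝ) - U * dhi * (L : ℝ) ^ 2) :
    TorusKineticLowerRow L U klo := by
  intro ψ hψ h1
  have hL0 : (0 : ℝ) < (L : ℝ) ^ 2 := by have := NeZero.pos L; positivity
  have hdψ := hd ψ hψ h1
  have he' : ((elo : ℚ) : ℝ) ≤ groundEnergyAt (fermionTorusGraph 2 L) 1 U (L ^ 2) := he
  have hUd : U * (doccDensity L ψ * (L : ℝ) ^ 2) ≤ U * (dhi * (L : ℝ) ^ 2) :=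
    mul_le_mul_of_nonneg_left (mul_le_mul_of_nonneg_right hdψ hL0.le) hU
  rw [kineticDensity_eq_groundEnergyAt_sub hψ h1, le_sub_iff_add_le, le_div_iff₀ hL0]
  nlinarith

/-- **`T{L}_k.hi` from `T{L}_E.hi` and `T{L}_D.lo`** (`U ≥ 0`): `ehi − U·dlo·L² ≤ khi·L²` gives
`TorusKineticUpperRow L U khi`. [cite: LiebWu1968, eq. (15)] [cite: Tasaki2020, §2.1] -/
theorem TorusKineticUpperRow.of_energyUpper_doccLower {U : ℝ} (hU : 0 ≤ U) {ehi dlo khi : ℚ}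
    (he : TorusEnergyUpperRow L U ehi) (hd : TorusDoccLowerRow L U dlo)
    (hk : (ehi : ℝ) - U * dlo * (L : ℝ) ^ 2 ≤ ((khi : ℚ) : ℝ) * (L : ℝ) ^ 2) :
    TorusKineticUpperRow L U khi := by
  intro ψ hψ h1
  have hL0 : (0 : ℝ) < (L : ℝ) ^ 2 := by have := NeZero.pos L; positivity
  have hdψ := hd ψ hψ h1
  have he' : groundEnergyAt (fermionTorusGraph 2 L) 1 U (L ^ 2) ≤ ((ehi : ℚ) : ℝ) := he
  have hUd : U * (dlo * (L : ℝ) ^ 2) ≤ U * (doccDensity L ψ * (L : ℝ) ^ 2) :=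
    mul_le_mul_of_nonneg_left (mul_le_mul_of_nonneg_right hdψ hL0.le) hU
  rw [kineticDensity_eq_groundEnergyAt_sub hψ h1, sub_le_iff_le_add, div_le_iff₀ hL0]
  nlinarith

/-- **THE DERIVED CELL `T{L}_k`** (`U ≥ 0`): the energy row `elo ≤ E₀ ≤ ehi` (total) and the docc row
`dlo ≤ d_L ≤ dhi` (per site) give `TorusKineticRow L U klo khi` for every rationals with
`klo·L² ≤ elo − U·dhi·L²` and `ehi − U·dlo·L² ≤ khi·L²` — exactly the interval arithmetic
`k ∈ [elo/L² − U·dhi, ehi/L² − U·dlo]` of the M2 table's `T{L}_k` cells, now a theorem per cell.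
[cite: LiebWu1968, eq. (15)] [cite: Tasaki2020, §2.1] -/
theorem TorusKineticRow.of_energy_docc {U : ℝ} (hU : 0 ≤ U) {elo ehi dlo dhi klo khi : ℚ}
    (he : TorusEnergyRow L U elo ehi) (hd : TorusDoccRow L U dlo dhi)
    (hklo : ((klo : ℚ) : ℝ) * (L : ℝ) ^ 2 ≤ (elo : ℝ) - U * dhi * (L : ℝ) ^ 2)
    (hkhi : (ehi : ℝ) - U * dlo * (L : ℝ) ^ 2 ≤ ((khi : ℚ) : ℝ) * (L : ℝ) ^ 2) :
    TorusKineticRow L U klo khi :=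
  TorusKineticRow.of_lower_upper
    (TorusKineticLowerRow.of_energyLower_doccUpper hU he.1 (torusDoccRow_iff.1 hd).2 hklo)
    (TorusKineticUpperRow.of_energyUpper_doccLower hU he.2 (torusDoccRow_iff.1 hd).1 hkhi)

/-- **Conversely, kinetic rows bound the double occupancy** (`U > 0`, `d_L = (E₀/L² − k_L)/U`): the
energy row and `TorusKineticRow L U klo khi` give `TorusDoccRow L U dlo dhi` whenever
`U·dlo·L² ≤ elo − khi·L²` and `ehi − klo·L² ≤ U·dhi·L²`. [cite: LiebWu1968, eq. (15)] [cite: Tasaki2020, §2.1] -/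
theorem TorusDoccRow.of_energy_kinetic {U : ℝ} (hU : 0 < U) {elo ehi klo khi dlo dhi : ℚ}
    (he : TorusEnergyRow L U elo ehi) (hk : TorusKineticRow L U klo khi)
    (hdlo : U * dlo * (L : ℝ) ^ 2 ≤ (elo : ℝ) - ((khi : ℚ) : ℝ) * (L : ℝ) ^ 2)
    (hdhi : (ehi : ℝ) - ((klo : ℚ) : ℝ) * (L : ℝ) ^ 2 ≤ U * dhi * (L : ℝ) ^ 2) :
    TorusDoccRow L U dlo dhi := by
  intro ψ hψ h1
  have hL0 : (0 : ℝ) < (L : ℝ) ^ 2 := by have := NeZero.pos L; positivity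
  obtain ⟨hkl, hku⟩ := hk ψ hψ h1
  have hel : ((elo : ℚ) : ℝ) ≤ groundEnergyAt (fermionTorusGraph 2 L) 1 U (L ^ 2) := he.1
  have heu : groundEnergyAt (fermionTorusGraph 2 L) 1 U (L ^ 2) ≤ ((ehi : ℚ) : ℝ) := he.2
  have hid := re_expect_hamiltonian_eq_kinetic_add_docc (L := L) U ψ
  rw [re_expect_hamiltonian_eq_groundEnergyAt _ hψ h1] at hid
  have hkl' : ((klo : ℚ) : ℝ) * (L : ℝ) ^ 2 ≤ (L : ℝ) ^ 2 * kineticDensity L ψ := by nlinarith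
  have hku' : (L : ℝ) ^ 2 * kineticDensity L ψ ≤ ((khi : ℚ) : ℝ) * (L : ℝ) ^ 2 := by nlinarith
  constructor
  · -- `U·dlo·L² ≤ elo − khi·L² ≤ E₀ − L²·k_L = U·(d_L·L²)`, then cancel `U > 0` and `L² > 0`
    have h4 : U * (((dlo : ℚ) : ℝ) * (L : ℝ) ^ 2) ≤ U * (doccDensity L ψ * (L : ℝ) ^ 2) := by
      nlinarith
    exact le_of_mul_le_mul_right (le_of_mul_le_mul_left h4 hU) hL0
  · -- `U·(d_L·L²) = E₀ − L²·k_L ≤ ehi − klo·L² ≤ U·dhi·L²`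
    have h4 : U * (doccDensity L ψ * (L : ℝ) ^ 2) ≤ U * (((dhi : ℚ) : ℝ) * (L : ℝ) ^ 2) := by
      nlinarith
    exact le_of_mul_le_mul_right (le_of_mul_le_mul_left h4 hU) hL0

end TorusKinetic

end M2

end Summit.Ventures.CertifiedManyBodySolver

end
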